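import Summits.BirchSwinnertonDyer.BirchSwinnertonDyer.Theorems.RamifiedHeegnerPairLeafRankZeroUpperAtThreeMonoCarrierAny
import HarnessLib

/-!
# Route `RamifiedHeegnerPair`, cruxes U₁ `LeafRankOneUpperAtThree` (26022) / U₀ (26024), research child Σ★″ (stmt-BirchSwinnertonDyer-27493) —
# the EXACT relation between the item Σ★″ and the weaker line stub Σ★‴ (skeletons v8 / v7): in every Heegner field in which `2` SPLITS they
# are interchangeable modulo print ∪ {F1, F2, F3}; the only gap is the `ℓ₀ = 2` corner (2 inert in `K`, `ρ̄₃` not onto)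

HONEST FRAMING. Theorems only; helper file (`--supports stmt-BirchSwinnertonDyer-26022 --as helper`); nothing is booked, no item is
closed, BSD is not proved for any curve; CONDITIONAL on every displayed input. Lead prover bsd-line-rhp-p2 g9, 2026-08-28.

* `sigmaStarOptOffMonoRows_of_sigmaStarOptOffRows` (p645042) gave Σ★″ (27493 BY NAME) ⟹ Σ★‴.
* HERE `sigmaStarOptOffRowsTwoSplit_of_namedFacts_of_sigmaStarOptOffMonoRows` : {modularity, Mazur / Abbes–Ullmo / Česnavičius Manin facts}
  → F1 → F2 → F3 → Σ★‴ → Σ★″|₂, where Σ★″|₂ := item 27493's text with ONE extra binder «`SatisfiesHeegnerHypothesis 2 K`» after the Heegner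
  hypothesis. On the rows newly covered by Σ★‴'s exclusion (one Tamagawa-`3` carrier of ANY reduction type) the divisibility is the any-carrier
  reading R|₂ at the datum (`sigmaAtDatum_three_of_anyCarrierReading_monoCarrierAny`, p645085; `3 ∤ c` by `not_three_dvd_c_of_latticeOptimal_of_subGss`);
  elsewhere it is Σ★‴ itself.
So for the compositions of record (all choose Friedberg–Hoffstein / Bump–Friedberg–Hoffstein fields with `2` split) the item 27493 and the stub Σ★‴
carry the same content; as TYPED (all `K`) 27493 exceeds Σ★‴ exactly by the reading on single-additive-carrier rows in fields with `2` inert and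
`ρ̄_{E,3}` not onto — the corner that also keeps 27492 open as typed (S2-EXIT-g8.md §3). Planner datum only; no restate asked.

References: [cite: Jetchev2008, Conj. 1.3, Thm. 1.4 (ii), Cor. 1.5 (p. 812)] [cite: GrossLMS1991, Prop. 3.7 (2) (p. 240), §6 p. 245]
[cite: MilneADT2006, Ch. I, Thm. 4.10(b)] [cite: GrossZagier1986, III (3.1)] [cite: Mazur1978, Cor. 4.1] [cite: Stevens1989, Lemmas (5.2), (5.4)]
[cite: Darmon2004, Thm. 3.6–3.7 (PDF pp. 43–44)].
-/

-- D-0017: single-problem summit, so `Summit.BirchSwinnertonDyer.BirchSwinnertonDyer.…` repeats a namespace BY DESIGN.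
set_option linter.dupNamespace false
set_option autoImplicit false

noncomputable section

open scoped Classical NumberField

open WeierstrassCurve IsDedekindDomain IsDedekindDomain.HeightOneSpectrum NumberField
  Rat.HeightOneSpectrum Literature Literature.NumberTheory.EllipticCurves
  Literature.NumberTheory.EllipticCurves.ModularForms
  Literature.NumberTheory.EllipticCurves.Rank1Residual
  Literature.NumberTheory.EllipticCurves.Rank1Residual.Typed
  Literature.NumberTheory.QuadraticFields
  Summit.BirchSwinnertonDyer.Rank1Residual
  Summit.BirchSwinnertonDyer.Rank1Residual.Additive
  Summit.BirchSwinnertonDyer.Rank1Residual.X11b.Three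
  Summit.BirchSwinnertonDyer.BirchSwinnertonDyer.Theses.RamifiedHeegnerPair
  Summit.BirchSwinnertonDyer.BirchSwinnertonDyer.Theorems
  Summit.BirchSwinnertonDyer.BirchSwinnertonDyer.Theorems.JetchevReadingAnyCarrier

namespace Summit.BirchSwinnertonDyer.BirchSwinnertonDyer.Theorems.RamifiedPairUpperBound

/-- **Σ★″|₂ ⟸ Σ★‴ ∧ {F1, F2, F3} ∧ the Manin facts (modularity, Mazur, Abbes–Ullmo, Česnavičius).** Σ★″|₂ := item 27493
`LeafSigmaStarDivisibilityAtThreeOptimalOffRows` with ONE extra binder «`SatisfiesHeegnerHypothesis 2 K`»; Σ★‴ := the registered research stub of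
skeletons v8 (26022) / v7 (26024) (27493's text with the excluded rows widened to the mono-carrier rows of ANY reduction type). Case split on the
mono-carrier predicate `∃ q ∣ N, ord₃ ∏c ≤ ord₃ c_q`: ON it, the any-carrier 2-split reading R|₂ (`anyCarrierTwoSplitReading_of_namedFacts`, p643642)
at the lattice-optimal datum (`3 ∤ c` by `not_three_dvd_c_of_latticeOptimal_of_subGss`) through `sigmaAtDatum_three_of_anyCarrierReading_monoCarrierAny`
(p645085); OFF it, Σ★‴. With `sigmaStarOptOffMonoRows_of_sigmaStarOptOffRows` (p645042): in fields with `2` split, 27493 and Σ★‴ are EQUIVALENT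
modulo print ∪ {F1, F2, F3}. CONDITIONAL; nothing asserted about any curve. [cite: Jetchev2008, Conj. 1.3, Thm. 1.4 (ii) (p. 812)]
[cite: GrossLMS1991, Prop. 3.7 (2)] [cite: MilneADT2006, Ch. I, Thm. 4.10(b)] [cite: GrossZagier1986, III (3.1)] [cite: Mazur1978, Cor. 4.1]
[cite: Stevens1989, Lemmas (5.2), (5.4)] -/
theorem sigmaStarOptOffRowsTwoSplit_of_namedFacts_of_sigmaStarOptOffMonoRows
    (hnf : exists_isNewformOf)
    (hM : mazur_not_dvd_maninConstant_of_odd) (hAU : abbesUllmo_not_dvd_maninConstant_of_not_dvd_level)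
    (hC2 : cesnavicius_not_two_dvd_maninConstant_of_two_dvd_level)
    (h37 : GrossLMS1991.prop37_2_frobeniusCongruence)
    (hPT : ∀ (K : Type) [Field K] [NumberField K],
      Literature.NumberTheory.GaloisCohomology.poitouTate_selmerStructure_duality_conj K)
    (hF1 : Gross1991_heegnerPoint_sub_ratTorsion_mem_E0_imageFree)
    (hStar : ∀ (W : WeierstrassCurve ℚ) [W.IsElliptic] [W.IsGloballyMinimal] (N : ℕ) [NeZero N]
      (K : Type) [Field K] [NumberField K]
      (Dt : ModularParametrizationData W N) (H : HeegnerDatum N (NumberField.discr K)) (ι : K →+* ℂ)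
      (P : (W.baseChange K).toAffine.Point),
      ¬ W.HasCM → Addv W 3 → SubGss W 3 → W.conductorNorm ℤ = N →
      (∀ z ∈ Dt.L.lattice, ∃ w ∈ periodLattice Dt.f, z = Dt.c * w) →
      ¬ (∃ (q : ℕ) (_ : Fact q.Prime), q ∣ N ∧
          padicValNat 3 W.tamagawaProduct ≤ padicValNat 3 ((W.baseChange ℚ_[q]).localTamagawaNumber ℤ_[q])) →
      IsImaginaryQuadratic K → SatisfiesHeegnerHypothesis N K →
      (WeierstrassCurve.Affine.Point.map ι.toRatAlgHom) P = heegnerPointComplex Dt H →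
      ¬ IsOfFinAddOrder P → Odd (NumberField.discr K) →
      ∀ (s' : ℕ), s' ≤ padicValNat 3 W.tamagawaProduct + padicValNat 3 Dt.c.natAbs →
      ∀ (n : ℕ) (d : KolyvaginHeegnerData Dt H.β ι n), Squarefree n →
      (∀ ℓ ∈ n.primeFactors, Zhang2014.IsKolyvaginPrime N W K 3 ℓ ∧ s' ≤ Zhang2014.kolyvaginIndex W 3 ℓ) →
      Koly.PDiv d 3 s') :
    ∀ (W : WeierstrassCurve ℚ) [W.IsElliptic] [W.IsGloballyMinimal] (N : ℕ) [NeZero N]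
      (K : Type) [Field K] [NumberField K]
      (Dt : ModularParametrizationData W N) (H : HeegnerDatum N (NumberField.discr K)) (ι : K →+* ℂ)
      (P : (W.baseChange K).toAffine.Point),
      ¬ W.HasCM → Addv W 3 → SubGss W 3 → W.conductorNorm ℤ = N →
      (∀ z ∈ Dt.L.lattice, ∃ w ∈ periodLattice Dt.f, z = Dt.c * w) →
      ¬ ((∃ (q : ℕ) (_ : Fact q.Prime), q ∣ N ∧ ¬ q ^ 2 ∣ N ∧
          padicValNat 3 W.tamagawaProduct ≤ padicValNat 3 ((W.baseChange ℚ_[q]).localTamagawaNumber ℤ_[q])) ∧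
        (∀ (q' : ℕ) [Fact q'.Prime], q' ∣ N →
          3 ∣ (W.baseChange ℚ_[q']).localTamagawaNumber ℤ_[q'] → ¬ q' ^ 2 ∣ N)) →
      IsImaginaryQuadratic K → SatisfiesHeegnerHypothesis N K → SatisfiesHeegnerHypothesis 2 K →
      (WeierstrassCurve.Affine.Point.map ι.toRatAlgHom) P = heegnerPointComplex Dt H →
      ¬ IsOfFinAddOrder P → Odd (NumberField.discr K) →
      ∀ (s' : ℕ), s' ≤ padicValNat 3 W.tamagawaProduct + padicValNat 3 Dt.c.natAbs →
      ∀ (n : ℕ) (d : KolyvaginHeegnerData Dt H.β ι n), Squarefree n →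
      (∀ ℓ ∈ n.primeFactors, Zhang2014.IsKolyvaginPrime N W K 3 ℓ ∧ s' ≤ Zhang2014.kolyvaginIndex W 3 ℓ) →
      Koly.PDiv d 3 s' := by
  intro W _ _ N _ K _ _ Dt H ι P hCM hadd hsub hN hopt _ hK hHN h2K hP hnt hodd s' hs' n d hn hℓ
  by_cases hrow : ∃ (q : ℕ) (_ : Fact q.Prime), q ∣ N ∧
      padicValNat 3 W.tamagawaProduct ≤ padicValNat 3 ((W.baseChange ℚ_[q]).localTamagawaNumber ℤ_[q])
  · -- a mono-carrier row of ANY reduction type: the any-carrier reading R|₂ at the (Manin-clean) lattice-optimal datum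
    obtain ⟨q, _, hqN, hmono⟩ := hrow
    subst hN
    exact sigmaAtDatum_three_of_anyCarrierReading_monoCarrierAny
      (JetchevReadingAnyCarrier.anyCarrierTwoSplitReading_of_namedFacts h37 hPT hF1) W hCM hadd hsub q hqN hmono Dt
      (not_three_dvd_c_of_latticeOptimal_of_subGss hM hAU hC2 hnf W Dt hopt hadd hsub) K H ι P hK hHN h2K hP hnt hodd s' hs' n d hn hℓ
  · -- off the mono-carrier rows: the research stub Σ★‴ itself
    exact hStar W N K Dt H ι P hCM hadd hsub hN hopt hrow hK hHN hP hnt hodd s' hs' n d hn hℓ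

end Summit.BirchSwinnertonDyer.BirchSwinnertonDyer.Theorems.RamifiedPairUpperBound

end
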